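import Mathlib
import Summits.QuantumFields.QCD.Theorems.QuarksAsStableActionUnquenchedChessboardBoundStubSitePeelPolar
import HarnessLib

/-!
# The polar datum of the diluted determinant and the abstract peeling inequality (stubs
`stub_torusPeel` / `stub_sitePeel` of crux stmt-QuantumFields-9735, line Sketch — wave-2 helper 3b)

* The bond combinatorics of the site reflection: `upperBonds`, `planeBonds`; the reflection of an
  upper bond set meets the upper bonds in its plane part (`mem_reflBonds_of_upper`).
* `polarDet A B`: the polar datum (helper 3a) of the diluted determinant for two upper bond sets
  with the same plane part; its pairings are `det D_{X_s ∪ θ X_{s'}}` (`form_polarDet`, from the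
  diluted Gram identity of helper 1b and the kernel positivity of helper 2).
* **`polar_main`**: for all `t ∈ ℂ`,
  `0 ≤ Zb(A ∪ θA) + conj t · Zb(A ∪ θB) + t · Zb(B ∪ θA) + conj t · t · Zb(B ∪ θB)`.
-/

noncomputable section

open Matrix Complex Finset MeasureTheory
open Literature.MathematicalPhysics.QuantumLattice Literature.MathematicalPhysics.QuantumFieldTheory
open Literature.Probability.LatticeModels
open Summit.QuantumFields.QCD.Theorems.QuarksAsStableAction
open scoped ComplexConjugate BigOperators Kronecker ComplexOrder

namespace Summit.QuantumFields.QCD.Theorems.UnquenchedChessboardBoundLine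

/-! ## Bond combinatorics of the site reflection -/

section Bonds

variable {L : ℕ} [NeZero L] [Fact (1 < L)]

omit [Fact (1 < L)] in
/-- The bonds joining two sites of the closed positive-time half `0 ≤ t ≤ L/2`. -/
def upperBonds : Finset (Edge 4 L) :=
  Finset.univ.filter fun b => tv b.1 ≤ L / 2 ∧ tv (Site.shift b.1 b.2) ≤ L / 2

omit [Fact (1 < L)] in
/-- The bonds joining two sites of the reflection planes `t = 0`, `t = L/2`. -/
def planeBonds : Finset (Edge 4 L) :=
  Finset.univ.filter fun b => (tv b.1 = 0 ∨ tv b.1 = L / 2) ∧ (tv (Site.shift b.1 b.2) = 0 ∨ tv (Site.shift b.1 b.2) = L / 2)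

omit [Fact (1 < L)] in
/-- Membership in `upperBonds`. -/
@[simp] theorem mem_upperBonds {b : Edge 4 L} : b ∈ upperBonds ↔ tv b.1 ≤ L / 2 ∧ tv (Site.shift b.1 b.2) ≤ L / 2 := by
  simp [upperBonds]

omit [Fact (1 < L)] in
/-- Membership in `planeBonds`. -/
@[simp] theorem mem_planeBonds {b : Edge 4 L} :
    b ∈ planeBonds ↔ (tv b.1 = 0 ∨ tv b.1 = L / 2) ∧ (tv (Site.shift b.1 b.2) = 0 ∨ tv (Site.shift b.1 b.2) = L / 2) := by
  simp [planeBonds]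

omit [Fact (1 < L)] in
/-- Plane bonds are upper bonds. -/
theorem planeBonds_subset_upperBonds : (planeBonds : Finset (Edge 4 L)) ⊆ upperBonds := by
  intro b hb
  rw [mem_planeBonds] at hb
  rw [mem_upperBonds]
  exact ⟨by rcases hb.1 with h | h <;> omega, by rcases hb.2 with h | h <;> omega⟩

/-- Plane bonds are spatial and fixed by the reflection. -/
theorem reflBond_of_mem_planeBonds (hL : Even L) (h4 : 4 ≤ L) {b : Edge 4 L} (hb : b ∈ planeBonds) : reflBond b = b := by
  have hL' := Nat.even_iff.1 hL
  obtain ⟨x, μ⟩ := b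
  rw [mem_planeBonds] at hb
  simp only at hb
  have hlt := tv_lt x
  have hk : μ ≠ 0 := by
    intro h0
    subst h0
    have e1 := tv_shift_zero x
    rcases hb with ⟨h1 | h1, h2 | h2⟩ <;> split_ifs at e1 <;> omega
  unfold reflBond
  rw [if_neg hk, siteTimeNeg_of_plane hL hb.1]

/-- The reflection of a non-plane upper bond is not an upper bond. -/
theorem reflBond_not_mem_upperBonds (hL : Even L) (h4 : 4 ≤ L) {b : Edge 4 L} (hb : b ∈ upperBonds)
    (hnp : b ∉ planeBonds) : reflBond b ∉ upperBonds := by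
  have hL' := Nat.even_iff.1 hL
  obtain ⟨x, μ⟩ := b
  rw [mem_upperBonds] at hb ⊢
  rw [mem_planeBonds] at hnp
  simp only at hb hnp
  have hlt := tv_lt x
  unfold reflBond
  by_cases hk : μ = 0
  · subst hk
    simp only [if_true]
    have e1 : tv (Site.shift x 0) = tv x + 1 := by rw [tv_shift_zero, if_neg (by omega)]
    have e2 : tv (siteTimeNeg (Site.shift x 0)) = L - (tv x + 1) := by rw [tv_siteTimeNeg, e1, if_neg (by omega)]
    have e3 : Site.shift (siteTimeNeg (Site.shift x 0)) 0 = siteTimeNeg x :=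
      ((siteTimeNeg_eq_shift_iff x (Site.shift x 0)).2 rfl).symm
    rw [e3, e2, tv_siteTimeNeg]
    rw [e1] at hb
    split_ifs with h0 <;> omega
  · simp only [hk, if_false]
    rw [← siteTimeNeg_shift_of_ne _ hk, tv_siteTimeNeg, tv_siteTimeNeg, tv_shift_ne _ hk]
    rw [tv_shift_ne _ hk] at hb hnp
    split_ifs with h0 <;> omega

/-- **An upper bond lies in the reflection of an upper bond set iff it is one of its plane bonds.** -/
theorem mem_reflBonds_of_upper (hL : Even L) (h4 : 4 ≤ L) {X : Finset (Edge 4 L)} (hX : X ⊆ upperBonds)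
    {b : Edge 4 L} (hb : b ∈ upperBonds) : b ∈ reflBonds X ↔ b ∈ planeBonds ∧ b ∈ X := by
  rw [mem_reflBonds]
  constructor
  · intro h
    by_cases hp : b ∈ planeBonds
    · rw [reflBond_of_mem_planeBonds hL h4 hp] at h
      exact ⟨hp, h⟩
    · exact absurd (hX h) (reflBond_not_mem_upperBonds hL h4 hb hp)
  · rintro ⟨hp, h⟩
    rwa [reflBond_of_mem_planeBonds hL h4 hp]

/-- The bonds of `X ∪ θY` and of `θ(X ∪ θY)` between upper sites, for upper sets `X, Y` with the same
plane bonds. -/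
theorem mem_union_reflBonds_of_upper (hL : Even L) (h4 : 4 ≤ L) {X Y : Finset (Edge 4 L)} (hX : X ⊆ upperBonds)
    (hY : Y ⊆ upperBonds) (hXY : ∀ b ∈ planeBonds, b ∈ X ↔ b ∈ Y) {b : Edge 4 L} (hb : b ∈ upperBonds) :
    (b ∈ X ∪ reflBonds Y ↔ b ∈ X) ∧ (b ∈ reflBonds (X ∪ reflBonds Y) ↔ b ∈ Y) := by
  constructor
  · rw [Finset.mem_union, mem_reflBonds_of_upper hL h4 hY hb]
    exact ⟨fun h => h.elim id fun h' => (hXY b h'.1).2 h'.2, Or.inl⟩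
  · rw [mem_reflBonds, Finset.mem_union, mem_reflBonds, reflBond_reflBond, ← mem_reflBonds,
      mem_reflBonds_of_upper hL h4 hX hb]
    exact ⟨fun h => h.elim (fun h' => (hXY b h'.1).1 h'.2) id, Or.inr⟩

omit [Fact (1 < L)] in
/-- Masks of bond sets with the same upper bonds agree on upper sites. -/
theorem bondMask_congr_upper {E E' : Finset (Edge 4 L)} (h : ∀ b ∈ upperBonds, b ∈ E ↔ b ∈ E')
    (x y : TorusSite 4 L) (hx : tv x ≤ L / 2) (hy : tv y ≤ L / 2) : bondMask E x y = bondMask E' x y :=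
  bondMask_congr fun μ => ⟨fun hμ => h _ (by rw [mem_upperBonds, ← hμ]; exact ⟨hx, hy⟩),
    fun hμ => h _ (by rw [mem_upperBonds, ← hμ]; exact ⟨hy, hx⟩)⟩

omit [Fact (1 < L)] in
/-- Masks of bond sets with the same plane bonds agree on plane sites. -/
theorem bondMask_congr_plane {E E' : Finset (Edge 4 L)} (h : ∀ b ∈ planeBonds, b ∈ E ↔ b ∈ E')
    (x y : TorusSite 4 L) (hx : tv x = 0 ∨ tv x = L / 2) (hy : tv y = 0 ∨ tv y = L / 2) :
    bondMask E x y = bondMask E' x y :=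
  bondMask_congr fun μ => ⟨fun hμ => h _ (by rw [mem_planeBonds, ← hμ]; exact ⟨hx, hy⟩),
    fun hμ => h _ (by rw [mem_planeBonds, ← hμ]; exact ⟨hy, hx⟩)⟩

end Bonds

/-! ## The polar datum of the diluted determinant -/

section Det

variable {L N : ℕ} [NeZero L] [Fact (1 < L)]

/-- **The polar datum of the diluted determinant** for two bond sets `A` (family `true`) and `B`
(family `false`): kernel `K_A`, features `ρ(P_A(U))` and `ρ(P_B(U))`. -/
def polarDet (hL : Even L) (h4 : 4 ≤ L) (A B : Finset (Edge 4 L)) {m : ℝ} (hm : -1 ≤ m) :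
    PolarData L (Matrix.specialUnitaryGroup (Fin N) ℂ) where
  κ := Finset (Fin (upCard L N)) × Finset (Fin (upCard L N))
  K U := gramKernelE A U m
  feat s I U := rho (upperBlockE (if s then A else B) U m) I.1 I.2
  psd U := posSemidef_gramKernelE hL h4 A U hm
  measK I J := by
    simp only [gramKernelE, Matrix.kroneckerMap_apply, Matrix.transpose_apply]
    exact measurable_of_continuous_cfg ((continuous_Gamma_comp (continuous_planeBlockE A m) _ _).mul
      (continuous_Gamma_comp (continuous_planeBlockE A m) _ _))
  bddK := by
    have hK : ∀ I J : Finset (Fin (upCard L N)) × Finset (Fin (upCard L N)),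
        Continuous fun U : GaugeConfig 4 L (Matrix.specialUnitaryGroup (Fin N) ℂ) => gramKernelE A U m I J := by
      intro I J
      simp only [gramKernelE, Matrix.kroneckerMap_apply, Matrix.transpose_apply]
      exact (continuous_Gamma_comp (continuous_planeBlockE A m) _ _).mul (continuous_Gamma_comp (continuous_planeBlockE A m) _ _)
    have hc : Continuous fun U : GaugeConfig 4 L (Matrix.specialUnitaryGroup (Fin N) ℂ) =>
        ∑ I : Finset (Fin (upCard L N)) × Finset (Fin (upCard L N)), ∑ J : Finset (Fin (upCard L N)) ×
          Finset (Fin (upCard L N)), ‖gramKernelE A U m I J‖ :=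
      continuous_finsetSum _ fun I _ => continuous_finsetSum _ fun J _ => (hK I J).norm
    obtain ⟨C, hC⟩ := exists_bound_of_continuous hc
    refine ⟨C, fun U I J => le_trans ?_ ((le_abs_self _).trans ((Real.norm_eq_abs _).symm.trans_le (hC U)))⟩
    exact (Finset.single_le_sum (f := fun J => ‖gramKernelE A U m I J‖) (fun _ _ => norm_nonneg _)
      (Finset.mem_univ J)).trans (Finset.single_le_sum (f := fun I => ∑ J, ‖gramKernelE A U m I J‖)
        (fun _ _ => Finset.sum_nonneg fun _ _ => norm_nonneg _) (Finset.mem_univ I))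
  depK I J U V hUV := by
    simp only [gramKernelE, Matrix.kroneckerMap_apply, Matrix.transpose_apply, dependsOn_planeBlockE hL h4 A m hUV]
  measF s I := measurable_of_continuous_cfg (continuous_rho_comp (continuous_upperBlockE _ m) _ _)
  bddF := by
    have hc : ∀ E : Finset (Edge 4 L), Continuous fun U : GaugeConfig 4 L (Matrix.specialUnitaryGroup (Fin N) ℂ) =>
        ∑ I : Finset (Fin (upCard L N)) × Finset (Fin (upCard L N)), ‖rho (upperBlockE E U m) I.1 I.2‖ := fun E =>
      continuous_finsetSum _ fun I _ => (continuous_rho_comp (continuous_upperBlockE E m) _ _).norm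
    obtain ⟨CA, hCA⟩ := exists_bound_of_continuous (hc A)
    obtain ⟨CB, hCB⟩ := exists_bound_of_continuous (hc B)
    refine ⟨max CA CB, fun s I U => ?_⟩
    have hle : ∀ E : Finset (Edge 4 L), ‖rho (upperBlockE E U m) I.1 I.2‖ ≤
        ‖∑ I : Finset (Fin (upCard L N)) × Finset (Fin (upCard L N)), ‖rho (upperBlockE E U m) I.1 I.2‖‖ := fun E =>
      (Finset.single_le_sum (f := fun I : Finset (Fin (upCard L N)) × Finset (Fin (upCard L N)) =>
        ‖rho (upperBlockE E U m) I.1 I.2‖) (fun _ _ => norm_nonneg _) (Finset.mem_univ I)).trans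
        ((le_abs_self _).trans (Real.norm_eq_abs _).symm.le)
    cases s
    · exact ((hle B).trans (hCB U)).trans (le_max_right _ _)
    · exact ((hle A).trans (hCA U)).trans (le_max_left _ _)
  depF s I U V hUV := by
    cases s <;> simp only [dependsOn_upperBlockE hL h4 _ m hUV]

/-- **The pairings of the polar datum are the diluted determinants** `det D_{X_s ∪ θX_{s'}}` for upper
bond sets `A ⊇_plane B` with the same plane bonds. -/
theorem form_polarDet (hL : Even L) (h4 : 4 ≤ L) {A B : Finset (Edge 4 L)} (hA : A ⊆ upperBonds) (hB : B ⊆ upperBonds)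
    (hAB : ∀ b ∈ planeBonds, b ∈ A ↔ b ∈ B) {m : ℝ} (hm : -1 ≤ m) (s s' : Bool)
    (U : GaugeConfig 4 L (Matrix.specialUnitaryGroup (Fin N) ℂ)) :
    (polarDet (N := N) hL h4 A B hm).form s s' U =
      (bondWilsonDiracAP ((if s then A else B) ∪ reflBonds (if s' then A else B)) U m).det := by
  set X : Finset (Edge 4 L) := if s then A else B with hXdef
  set Y : Finset (Edge 4 L) := if s' then A else B with hYdef
  have hX : X ⊆ upperBonds := by rw [hXdef]; split_ifs <;> assumption
  have hY : Y ⊆ upperBonds := by rw [hYdef]; split_ifs <;> assumption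
  have hXY : ∀ b ∈ planeBonds, b ∈ X ↔ b ∈ Y := by
    intro b hb; rw [hXdef, hYdef]
    split_ifs <;> first | rfl | exact hAB b hb | exact (hAB b hb).symm
  have hXA : ∀ b ∈ planeBonds, b ∈ X ↔ b ∈ A := by
    intro b hb; rw [hXdef]
    split_ifs <;> first | rfl | exact (hAB b hb).symm
  have hup := fun b (hb : b ∈ upperBonds) => mem_union_reflBonds_of_upper hL h4 hX hY hXY hb
  have h1 : upperBlockE (N := N) (X ∪ reflBonds Y) U m = upperBlockE X U m :=
    upperBlockE_congr (bondMask_congr_upper fun b hb => (hup b hb).1) U m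
  have h2 : upperBlockE (N := N) (reflBonds (X ∪ reflBonds Y)) (GaugeConfig.negReflect U) m =
      upperBlockE Y (GaugeConfig.negReflect U) m :=
    upperBlockE_congr (bondMask_congr_upper fun b hb => (hup b hb).2) _ m
  have h3 : planeBlockE (N := N) (X ∪ reflBonds Y) U m = planeBlockE A U m :=
    planeBlockE_congr (bondMask_congr_plane fun b hb =>
      ((hup b (planeBonds_subset_upperBonds hb)).1.trans (hXA b hb))) U m
  rw [det_bondWilsonDiracAP_eq_gram hL h4, PolarData.form]
  simp only [polarDet, gramKernelE, h1, h2, h3]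
  rfl

end Det

/-! ## The abstract peeling inequality -/

/-- **The polarised site-reflection positivity inequality for diluted determinants.** For upper bond
sets `A, B` with the same plane bonds, all `m_f ≥ -1` (well, `> -1`) and every `t ∈ ℂ`:
`0 ≤ Zb(A ∪ θA) + conj t · Zb(A ∪ θB) + t · Zb(B ∪ θA) + conj t · t · Zb(B ∪ θB)`. -/
theorem polar_main {Nf L : ℕ} [NeZero L] [Fact (1 < L)] (hL : Even L) (h4 : 4 ≤ L) (β : ℝ)
    (m : Fin Nf → ℝ) (hm : ∀ f, -1 < m f) {A B : Finset (Edge 4 L)} (hA : A ⊆ upperBonds) (hB : B ⊆ upperBonds)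
    (hAB : ∀ b ∈ planeBonds, b ∈ A ↔ b ∈ B) (t : ℂ) :
    0 ≤ (∫ U, (∏ f, (bondWilsonDiracAP (A ∪ reflBonds A) U (m f)).det) *
            (Real.exp (-β * wilsonAction (fundamentalRep (Fin 3)) U) : ℂ)
          ∂(Measure.pi fun _ : Edge 4 L => haarProbability (Matrix.specialUnitaryGroup (Fin 3) ℂ))) +
      conj t * (∫ U, (∏ f, (bondWilsonDiracAP (A ∪ reflBonds B) U (m f)).det) *
            (Real.exp (-β * wilsonAction (fundamentalRep (Fin 3)) U) : ℂ)
          ∂(Measure.pi fun _ : Edge 4 L => haarProbability (Matrix.specialUnitaryGroup (Fin 3) ℂ))) +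
      t * (∫ U, (∏ f, (bondWilsonDiracAP (B ∪ reflBonds A) U (m f)).det) *
            (Real.exp (-β * wilsonAction (fundamentalRep (Fin 3)) U) : ℂ)
          ∂(Measure.pi fun _ : Edge 4 L => haarProbability (Matrix.specialUnitaryGroup (Fin 3) ℂ))) +
      conj t * t * (∫ U, (∏ f, (bondWilsonDiracAP (B ∪ reflBonds B) U (m f)).det) *
            (Real.exp (-β * wilsonAction (fundamentalRep (Fin 3)) U) : ℂ)
          ∂(Measure.pi fun _ : Edge 4 L => haarProbability (Matrix.specialUnitaryGroup (Fin 3) ℂ))) := by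
  set D : PolarData L (Matrix.specialUnitaryGroup (Fin 3) ℂ) :=
    (polarProd fun f => polarDet (N := 3) hL h4 A B (hm f).le).mul
      (PolarData.ofGram (gramDataGauge hL (fundamentalRep (Fin 3)) (continuous_fundamentalRep (Fin 3)) β)) with hD
  have hform : ∀ (s s' : Bool) (U : GaugeConfig 4 L (Matrix.specialUnitaryGroup (Fin 3) ℂ)), D.form s s' U =
      (∏ f, (bondWilsonDiracAP ((if s then A else B) ∪ reflBonds (if s' then A else B)) U (m f)).det) *
        (Real.exp (-β * wilsonAction (fundamentalRep (Fin 3)) U) : ℂ) := by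
    intro s s' U
    rw [hD, PolarData.form_mul, form_polarProd, PolarData.form_ofGram]
    simp_rw [form_polarDet hL h4 hA hB hAB]
  have key := D.integral_lin_nonneg hL t
  simp only [hform, if_true, if_false, Bool.false_eq_true] at key
  exact key

end Summit.QuantumFields.QCD.Theorems.UnquenchedChessboardBoundLine

end
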